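import Literature.AlgebraicGeometry.Resolution.ZariskiPatchingProperModels
import Literature.AlgebraicGeometry.Resolution.ProperModelsPatchingOfResolution
import Literature.AlgebraicGeometry.Resolution.ResolutionLU
import HarnessLib

/-!
# Zariski's patching programme with proper models and WEAK local uniformization

**Sources.** O. Zariski, *Reduction of the singularities of algebraic three dimensional
varieties*, Ann. of Math. **45** (1944) 472–542 (Fundamental Theorem, p. 539); O. Piltant, *An
axiomatic version of Zariski's patching theorem*, RACSAM **107** (2013) 91–121, Prop. 5.1
(`P = P_reg`) and Cor. 5.7; p. 2 (open in dimension `≥ 4`).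

**What is reproduced.** `ZariskiPatchingProperModels.lean` proves "two-model patching of PROPER
models + RELATIVE local uniformization ⇒ resolution" and
`ProperModelsPatchingOfResolution.lean` the equivalence
`ResolutionInChar.{0} p ↔ TwoModelPatching.{0} p ∧ LUrel_p`. The patching argument uses local
uniformization only through ONE regular affine model at each point of the Zariski–Riemann space
(`ZariskiRiemannSpace.HasRegularCentre`), i.e. through WEAK local uniformization
(`IsLocallyUniformizable`; cf. `hasResolution_of_twoModelPatching_of_uniformizable` for
projective models). This file records the proper-model theorems with the weak hypothesis:

* `hasResolution_of_properPatching_of_uniformizable` — integral closed `X ⊆ ℙⁿ_k`: two-model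
  patching of proper models over `k` + a regular affine model at every valuation ⇒
  `Scheme.HasResolution X` (proof verbatim that of `hasResolution_of_properPatching_of_relLU`);
* `resolutionOverUpToDim_of_properPatching_of_lu` — weak LU over `k` (`IsLocallyUniformizable`
  for every valuation ring `O ⊇ k` of every finitely generated `K/k`) + proper two-model
  patching over `k` ⇒ `ResolutionOverUpToDim k d` for every `d`;
* `resolutionInChar_of_properTwoModelPatching_of_lu`, `resolutionInChar_iff_twoModelPatching_and_lu`
  — in every universe: `ResolutionInChar p ↔ ProperModel.TwoModelPatching p ∧
  LocalUniformizationInChar p` (CLAIMED STRENGTHENING of the tree's `.{0}`/relative form only in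
  the bookkeeping sense: weak instead of relative LU, universe-polymorphic; the mathematics is
  Zariski's and Piltant's).
-/

noncomputable section

open CategoryTheory AlgebraicGeometry TopologicalSpace IsLocalRing

namespace Literature.AlgebraicGeometry.Resolution

universe u

/-- **Resolution of an integral projective variety of any dimension from two-model patching of
proper models and ONE regular affine model per valuation** (Zariski 1944; Piltant 2013, Prop. 5.1
and Cor. 5.7, proper models, weak LU). Proof verbatim that of
`hasResolution_of_properPatching_of_relLU` with the resolving system read off the hypothesis
`hreg`. [cite: Piltant2013, Prop. 5.1 and Cor. 5.7] -/
theorem hasResolution_of_properPatching_of_uniformizable {k : Type u} [Field k]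
    (hZ : ∀ (K : Type u) [Field K] [Algebra k K] [Algebra.EssFiniteType k K],
      ∀ M₁ M₂ : ProperModel k K,
        ∃ (N : ProperModel k K) (φ₁ : N.Hom M₁) (φ₂ : N.Hom M₂), φ₁.RegLe ∧ φ₂.RegLe)
    (hreg : ∀ (K : Type u) [Field K] [Algebra k K] (A₀ : Subalgebra k K), A₀.FG →
      IsFractionRing A₀ K → ∀ v : ZariskiRiemannSpace k K, ∃ T : Subalgebra k K,
        (T.FG ∧ IsFractionRing T K) ∧ ZariskiRiemannSpace.HasRegularCentre T v)
    {n : ℕ} (X : Scheme.{u}) [IsIntegral X]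
    (ι : X ⟶ (Motives.projectiveSpace n k).left) [IsClosedImmersion ι] :
    Scheme.HasResolution X := by
  classical
  haveI : IsProper (Motives.projectiveSpace n k).hom := Motives.isProper_projectiveSpace n k
  let πX : X ⟶ Spec (.of k) := ι ≫ (Motives.projectiveSpace n k).hom
  have hproj : Motives.IsProjectiveOver (Over.mk πX) := ⟨n, Over.homMk ι rfl, ‹_›⟩
  haveI : LocallyOfFiniteType πX := inferInstance
  -- an affine chart `U = Spec A` of `X`
  obtain ⟨_, ⟨U', hU', rfl⟩, hηU, -⟩ := X.isBasis_affineOpens.exists_subset_of_mem_open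
    (Set.mem_univ (genericPoint X)) isOpen_univ
  let U : X.Opens := U'
  have hU : IsAffineOpen U := hU'
  haveI : IsAffine U := hU
  haveI : Nonempty U := ⟨⟨_, hηU⟩⟩
  let A : Type u := Γ(U, ⊤)
  -- `A` is a finitely generated `k`-algebra
  let g : (U : Scheme.{u}) ⟶ Spec (.of k) := U.ι ≫ πX
  let ψ : k →+* A := g.appTop.hom.comp (Scheme.ΓSpecIso (.of k)).inv.hom
  have hψ : ψ.FiniteType := by
    have h1 : g.appTop.hom.FiniteType :=
      (HasRingHomProperty.iff_of_isAffine (P := @LocallyOfFiniteType)).mp inferInstance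
    exact h1.comp (RingHom.FiniteType.of_surjective _
      (Scheme.ΓSpecIso (.of k)).symm.commRingCatIsoToRingEquiv.surjective)
  letI : Algebra k A := ψ.toAlgebra
  haveI hft : Algebra.FiniteType k A := hψ
  -- its fraction field `K`, and `X` as a projective model of `K/k`
  let K : Type u := FractionRing A
  let j : Spec (.of A) ⟶ X := U.toScheme.isoSpec.inv ≫ U.ι
  have hj : j ≫ πX = Spec.map (CommRingCat.ofHom (algebraMap k A)) := by
    change (U.toScheme.isoSpec.inv ≫ U.ι) ≫ πX = Spec.map (CommRingCat.ofHom ψ)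
    rw [Category.assoc, isoSpec_inv_comp]
    rfl
  let M₀ : ProjModel k K := ProjModel.ofChart (K := K) X πX hproj A j hj
  -- `A` as a subalgebra `A₀ ⊆ K`, finitely generated with `Frac A₀ = K`
  let toK : A →ₐ[k] K := IsScalarTower.toAlgHom k A K
  have htoK : Function.Injective toK := IsFractionRing.injective A K
  let A₀ : Subalgebra k K := toK.range
  have hA₀fg : A₀.FG := by
    rw [show A₀ = Subalgebra.map toK ⊤ from (Algebra.map_top toK).symm]
    exact Subalgebra.FG.map toK hft.out
  haveI hA₀fr : IsFractionRing A₀ K := by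
    refine IsFractionRing.of_field A₀ K fun z => ?_
    obtain ⟨a, b, -, rfl⟩ := IsFractionRing.div_surjective (A := A) z
    exact ⟨⟨algebraMap A K a, a, rfl⟩, ⟨algebraMap A K b, b, rfl⟩, rfl⟩
  -- a finite resolving system of affine models, from the hypothesis `hreg`
  have hcov : ∀ v : ZariskiRiemannSpace k K, ∃ T : Subalgebra k K,
      (T.FG ∧ IsFractionRing T K) ∧ ZariskiRiemannSpace.HasRegularCentre T v :=
    fun v => hreg K A₀ hA₀fg hA₀fr v
  obtain ⟨𝒯, h𝒯, h𝒯cov⟩ := exists_finite_resolvingSystem' (P := fun T => IsFractionRing T K)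
    (fun T hT => (isJ2Ring_of_field k).2 T ((Subalgebra.fg_iff_finiteType T).mp hT)) hcov
  -- their projective closures, as PROPER models: a finite resolving system of proper models
  have hM : ∀ T : ↥𝒯, ∃ M : ProperModel k K, ∀ w : ZariskiRiemannSpace k K,
      ZariskiRiemannSpace.HasRegularCentre T.1 w → M.RegCentre w := fun T => by
    haveI := (h𝒯 T.1 T.2).2
    obtain ⟨M, hM⟩ := ProjModel.exists_regCentre_of_hasRegularCentre T.1 (h𝒯 T.1 T.2).1
    exact ⟨M.toProperModel, fun w hw => (M.toProperModel_regCentre_iff w).mpr (hM w hw)⟩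
  choose M hM using hM
  let l : List (ProperModel k K) := 𝒯.attach.toList.map M
  have hlcov : ∀ v : ZariskiRiemannSpace k K, ∃ N ∈ l, N.RegCentre v := by
    intro v
    obtain ⟨T, hT, hTv⟩ := h𝒯cov v
    refine ⟨M ⟨T, hT⟩, ?_, hM ⟨T, hT⟩ v hTv⟩
    exact List.mem_map.mpr ⟨⟨T, hT⟩, Finset.mem_toList.mpr (Finset.mem_attach _ _), rfl⟩
  -- patch
  haveI : Algebra.EssFiniteType k K := inferInstance
  exact ProperModel.hasResolution_of_resolvingSystem_of_regLe (hZ K) M₀.toProperModel l hlcov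

/-- **Weak resolution in every dimension over `k` from WEAK local uniformization over `k` and
two-model patching of proper models over `k`.** [cite: Piltant2013, Prop. 5.1 and Cor. 5.7] -/
theorem resolutionOverUpToDim_of_properPatching_of_lu {k : Type u} [Field k]
    (hZ : ∀ (K : Type u) [Field K] [Algebra k K] [Algebra.EssFiniteType k K],
      ∀ M₁ M₂ : ProperModel k K,
        ∃ (N : ProperModel k K) (φ₁ : N.Hom M₁) (φ₂ : N.Hom M₂), φ₁.RegLe ∧ φ₂.RegLe)
    (hLU : ∀ (K : Type u) [Field K] [Algebra k K], (⊤ : IntermediateField k K).FG →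
      ∀ O : ValuationSubring K, (∀ c : k, algebraMap k K c ∈ O) → IsLocallyUniformizable k K O)
    (d : ℕ) : ResolutionOverUpToDim k d := by
  have hU : ∀ (K : Type u) [Field K] [Algebra k K] (A₀ : Subalgebra k K), A₀.FG →
      IsFractionRing A₀ K → ∀ v : ZariskiRiemannSpace k K, ∃ T : Subalgebra k K,
        (T.FG ∧ IsFractionRing T K) ∧ ZariskiRiemannSpace.HasRegularCentre T v := by
    intro K _ _ A₀ hA₀fg hA₀fr v
    haveI : Algebra.FiniteType k A₀ := A₀.fg_iff_finiteType.mp hA₀fg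
    haveI : Algebra.EssFiniteType A₀ K :=
      Algebra.EssFiniteType.of_isLocalization K (nonZeroDivisors A₀)
    have hKfg : (⊤ : IntermediateField k K).FG :=
      IntermediateField.fg_top_iff.mpr (Algebra.EssFiniteType.comp k A₀ K)
    exact exists_hasRegularCentre_of_lu (hLU K hKfg) v
  exact ResolutionOverUpToDim.of_projective fun _ X ι hι hint _ => by
    haveI := hι
    haveI := hint
    exact hasResolution_of_properPatching_of_uniformizable hZ hU X ι

/-- **Resolution in characteristic `p` from WEAK local uniformization in characteristic `p` and
two-model patching of proper models** (every universe). [cite: Piltant2013, p. 2 and Prop. 5.1] -/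
theorem resolutionInChar_of_properTwoModelPatching_of_lu {p : ℕ}
    (hZ : ProperModel.TwoModelPatching.{u} p) (hLU : LocalUniformizationInChar.{u} p) :
    ResolutionInChar.{u} p := by
  intro k _ _ X f hs hl hq hr
  haveI : QuasiCompact f := hq
  haveI : LocallyOfFiniteType f := hl
  haveI : CompactSpace X := QuasiCompact.compactSpace_of_compactSpace f
  obtain ⟨d, hd⟩ := exists_topologicalKrullDim_le_of_locallyOfFiniteType f
  exact resolutionOverUpToDim_of_properPatching_of_lu (fun K _ _ _ => hZ k K)
    (fun K _ _ hfg O hO => hLU k K hfg O hO) d X f hs hl hq hr hd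

/-- **Resolution in characteristic `p` ⟺ two-model patching of proper models ∧ weak local
uniformization in characteristic `p`**, in every universe (`⇒`:
`ProperModel.twoModelPatching_of_resolutionInChar`, `ResolutionInChar.localUniformizationInChar`).
[cite: Piltant2013, Prop. 5.1 and Cor. 5.7] -/
theorem resolutionInChar_iff_twoModelPatching_and_lu {p : ℕ} :
    ResolutionInChar.{u} p ↔
      ProperModel.TwoModelPatching.{u} p ∧ LocalUniformizationInChar.{u} p :=
  ⟨fun h => ⟨ProperModel.twoModelPatching_of_resolutionInChar h, h.localUniformizationInChar⟩,
    fun h => resolutionInChar_of_properTwoModelPatching_of_lu h.1 h.2⟩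

end Literature.AlgebraicGeometry.Resolution

end
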